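import Summits.QuantumFields.BalabanUV.T4Continuum.Support.ShellMeasureLiveEndOneCallGibbs
import Summits.QuantumFields.BalabanUV.T4Continuum.Support.ShellMeasureLevelZeroBoxWitness

/-!
# `T4Continuum.ShellMeasureLiveEndOneCallGibbsWitness` — row S92 f1b, rule G-1 (x1) IN KERNEL: the Gibbs-slot binder family of
# `ShellMeasureLiveEndOneCallGibbs.hac_gibbs_of_face` is JOINTLY INHABITED at the INTENDED scales — every Gibbs slot at lattice
# level `jl ≡ 0` of a genuine torus with a NONEMPTY block, while the run's scale profile `η r j = 2^{−j} → 0`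
(cell `pub-balaban`, sub-cell `t4`, spine estimate NE7c (node U5b); NE7c ROUND-2 crew, unit `b2b-balaban-t4-ne7c-formalise-leaf-06`
gen 7; companion of this seat's S92 f1b `ShellMeasureLiveEndOneCallGibbs` (p231442) answering, for the Gibbs leg, the η-lens
question raised by FINDING F-ne7cL05g9-1 on S92 file 1 (leaf-05-g9: a number SHARED across levels but displayed against
`η r (jl r K s)` is forced to `0` when the indexed levels exhaust ℕ); ADDITIVE — imports f1b and leaf-10-g11's S89 f1
`ShellMeasureLevelZeroBoxWitness` (p229619) ONLY; [folklore]; 0 `def`, 0 `def … : Prop`, 0 sorry, 0 citation tags)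

HONEST FRAMING.  A CONSISTENCY CERTIFICATE of OUR wiring; nothing of Bałaban's; finite four-torus programme, rung (B)+1 only —
NOT infinite volume, NOT a mass gap, NOT the Clay problem; NE7c (`T4IndicatorShell.ShellWeightBound`) NOT PRINTED, NOT
PROVED; «NE7c ⇐ the named binders» (c3); (M1)₀ on a concrete block ≠ NE7c.  HONEST DEPENDENCY (cell): continuum YM on T⁴ ⇐
BetaPertH ∧ nine spine estimates (0/9 proved); BetaPertH ⇐ (D1) ∧ (D4) ∧ CAP+tail; G-an2-4 gates asym, D1 and NE2/3/4.

THE POINT.  f1b's hypotheses are quantified UNGUARDED over `(r, K, s)` (file 1's convention) and its ONLY scale-coupled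
display is (SM)₀ `4(8S)²e^{16S} ≤ δ·(ε r (K − lvl r K s)·η r (jl r K s)²)` with the chart radius `S` SHARED.  Were the
indexed lattice levels `jl r K s` of the Gibbs family to exhaust ℕ along a profile `η r j → 0`, this display would be
UNSATISFIABLE for `S > 0` — the F-ne7cL05g9-1 mechanism.  It does not bite: a Gibbs slot IS a slot at lattice level 0
(`jl ≡ 0` on the Gibbs index type), so only `η r 0` (the unit-lattice scale) enters, whatever the profile does at `j ≥ 1`;
and the age enters only through `ε r (K − lvl r K s)` on finitely many live ages (idle indices carry age `0` by the free
choice `lvl r K s := K`).  THIS FILE fires `hac_gibbs_of_face` with EVERY binder discharged in kernel at such data: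
torus `toyParams` (`d = 2`, six sites per direction) at level `0` for every index, corner `0`, side-2 box, block
`Λ := blockBonds 0 2` (NONEMPTY, S89 f1), `P_u := boxPlaqF 0 2`, `P_w := ∅`, chart radius `S = 10⁻⁴`, co-test threshold
`σc = 2·10⁻⁵`, `δ = ½`, profiles `ε ≡ 2·10⁻⁵`, `ρ ≡ ¼`, `β ≡ β₀ ≥ 0`, **`η r j := (1∕2)^j`** (→ 0), `jl ≡ 0`, `lvl r K s := K`:
**`gibbs_family_fires`** — the conclusion of `hac_gibbs_of_face` at these data, for every `r K t s`, i.e.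
`SlotAntiConcentration ((fieldMeasure toyParams 0 SU2).withDensity (giF 0 2 σc β₀ ∅)) (fun U => wilsonU _ U ∕ ((1∕2)^0)²) (2·10⁻⁵) (1∕4) (…)`,
`gibbs_family_fires_reduced` — the same with the families evaluated (`η r 0 = 1`, `P_w = ∅`: plain (M1)₀ at threshold
`2·10⁻⁵`, width `¼`, constant `2·#(Λ × Fin 3)∕(1−½)`), + `gibbs_family_block_nonempty`.  S89 f2 `shellMass_pos` gives the
live shell POSITIVE realized mass at the same data (not re-imported here).  NOTHING in the countdown moves; NE7c NOT PROVED; spine PROVED 0∕9.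
-/

noncomputable section

open Set MeasureTheory

namespace Summit.QuantumFields.BalabanUV.T4Continuum.ShellMeasureLiveEndOneCallGibbsWitness

open scoped ENNReal
open Literature.MathematicalPhysics.QuantumFieldTheory.Balaban1983to89
open T4ShellMeasure (SlotAntiConcentration)
open T4CubeChartGnomonic (SU2)
open ShellMeasureWilsonRealizedSU2 (wilsonU)
open ShellMeasureWilsonGaugeInvariant (giF)
open ShellMeasureSmallnessArithmetic (sm0_of_window)
open ShellMeasureLevelZeroBoxWitness (blockBonds boxPlaqF toyParams toyParams_sitesPerDir blockBonds_box
  disjoint_blockBonds_comb cover_blockBonds boxPlaqF_box blockBonds_nonempty boxPlaqF_nonempty dir_zero_lt_one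
  side_two_nonwrapping side_two_side side_two_square)
open ShellMeasureLiveEndOneCallGibbs (hac_gibbs_of_face)

/-- **THE GIBBS FAMILY OF S92 f1b FIRES AT THE INTENDED SCALES** (rule G-1 (x1) in kernel; see the module docstring for the
data).  Every binder of `hac_gibbs_of_face` discharged: box geometry by S89 f1, numbers by `norm_num`, the reach
`1·2·σc ≤ 2S∕π` from `π ≤ 4`, both (SM)₀ displays by S21 `sm0_of_window` — at `η r (jl r K s) = (1∕2)^0 = 1` although
`η r j → 0`. [folklore] -/
theorem gibbs_family_fires [DecidableEq (PBond toyParams 0)] {σ : Type*} {β₀ : ℝ} (hβ₀ : 0 ≤ β₀) :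
    ∀ (r : Bool) (K : ℕ) (t : ℝ) (s : σ),
      SlotAntiConcentration
        ((fieldMeasure toyParams 0 SU2).withDensity
          (giF (0 : Fin toyParams.d → ℤ) (fun _ => (0 : ℤ) + 2) (2 / 10 ^ 5) β₀ (∅ : Finset (Plaq toyParams 0))))
        (fun U => wilsonU (boxPlaqF_nonempty (P := toyParams) (j := 0) (dir_zero_lt_one (le_refl 2))
          (side_two_square (P := toyParams) (0 : Fin toyParams.d → ℤ) _ _ (dir_zero_lt_one (le_refl 2)))) U /
          (fun (_ : Bool) (j : ℕ) => (1 / 2 : ℝ) ^ j) r ((fun (_ : Bool) (_ : ℕ) (_ : σ) => 0) r K s) ^ 2)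
        ((fun (_ : Bool) (_ : ℕ) => (2 / 10 ^ 5 : ℝ)) r (K - (fun (_ : Bool) (K : ℕ) (_ : σ) => K) r K s))
        ((fun (_ : Bool) (_ : ℕ) => (1 / 4 : ℝ)) r ((fun (_ : Bool) (K : ℕ) (_ : σ) => K) r K s))
        (2 * (((Fintype.card (↥(blockBonds (P := toyParams) (j := 0) 0 (fun _ => (0 : ℤ) + 2)) × Fin 3) : ℕ) : ℝ) +
          (fun (_ : Bool) (_ : ℕ) => β₀) r ((fun (_ : Bool) (_ : ℕ) (_ : σ) => 0) r K s) *
            ∑ _p ∈ (∅ : Finset (Plaq toyParams 0)), (8 * (1 / 10 ^ 4 : ℝ)) * (8 + 4 * (8 * (1 / 10 ^ 4 : ℝ)))) /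
          (1 - 1 / 2)) := by
  have hd : 2 ≤ toyParams.d := le_rfl
  have h3 : 3 ≤ toyParams.sitesPerDir 0 := by rw [toyParams_sitesPerDir]; norm_num
  have h01 := dir_zero_lt_one hd
  have hsq := side_two_square (P := toyParams) (0 : Fin toyParams.d → ℤ) _ _ h01
  have hN := side_two_nonwrapping (j := 0) h3 (0 : Fin toyParams.d → ℤ)
  have hπ4 := Real.pi_le_four
  have hπ3 := Real.pi_gt_three
  have hrad : ((toyParams.d - 1 : ℕ) : ℝ) * (2 : ℕ) * (2 / 10 ^ 5 : ℝ) ≤ 2 * (1 / 10 ^ 4) / Real.pi := by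
    rw [le_div_iff₀ Real.pi_pos]
    simp only [toyParams, Nat.cast_ofNat]
    norm_num
    nlinarith
  have hSM : 4 * (8 * (1 / 10 ^ 4 : ℝ)) ^ 2 * Real.exp (2 * (8 * (1 / 10 ^ 4 : ℝ))) ≤ 1 / 2 * (2 / 10 ^ 5) :=
    sm0_of_window (by norm_num) (by norm_num)
  exact hac_gibbs_of_face (σ := σ) (fun _ _ _ => toyParams) (fun _ _ _ => 0) (fun _ K _ => K)
    (ε := fun _ _ => 2 / 10 ^ 5) (η := fun _ j => (1 / 2 : ℝ) ^ j) (ρ := fun _ _ => 1 / 4) (β := fun _ _ => β₀)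
    (fun _ j => by positivity) (fun _ _ => by norm_num) (fun _ _ => by norm_num)
    (fun _ _ _ => (0 : Fin toyParams.d → ℤ)) (fun _ _ _ => fun _ => (0 : ℤ) + 2) (mb := fun _ _ _ => 2)
    (fun _ _ _ => hN) (fun _ _ _ => side_two_side (P := toyParams) 0)
    (fun _ _ _ => blockBonds 0 _) (fun _ _ _ => blockBonds_box 0 _) (fun _ _ _ => disjoint_blockBonds_comb 0 _)
    (fun _ _ _ => cover_blockBonds 0 _) (fun _ _ _ => Fintype.equivFin _)
    (S := 1 / 10 ^ 4) (by norm_num) (by norm_num) (by nlinarith)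
    (σc := fun _ _ _ => 2 / 10 ^ 5) (fun _ _ _ => by norm_num) (fun _ _ _ => hrad)
    (fun _ _ _ => boxPlaqF_nonempty (P := toyParams) (j := 0) h01 hsq) (fun _ _ _ => boxPlaqF_box 0 _)
    (fun _ _ _ => ∅) (δ := 1 / 2) (by norm_num) (by norm_num) (fun _ _ => by norm_num) (fun _ _ => hβ₀)
    (fun _ _ _ => by simpa using hSM) (fun _ _ _ => hSM)

/-- **THE SAME, REDUCED** (the indexed families evaluated: `η r 0 = 1`, `ε ≡ 2·10⁻⁵`, `ρ ≡ ¼`, `P_w = ∅`): plain (M1)₀ for the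
realized Gibbs face of the side-2 block with the Wilson classifier, threshold `2·10⁻⁵`, width `¼`, constant `2·#(Λ × Fin 3)∕(1−½)`
— for EVERY index `(r, K, t, s)` of the family. [folklore] -/
theorem gibbs_family_fires_reduced [DecidableEq (PBond toyParams 0)] {σ : Type*} {β₀ : ℝ} (hβ₀ : 0 ≤ β₀) :
    ∀ (_r : Bool) (_K : ℕ) (_t : ℝ) (_s : σ),
      SlotAntiConcentration
        ((fieldMeasure toyParams 0 SU2).withDensity
          (giF (0 : Fin toyParams.d → ℤ) (fun _ => (0 : ℤ) + 2) (2 / 10 ^ 5) β₀ (∅ : Finset (Plaq toyParams 0))))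
        (wilsonU (boxPlaqF_nonempty (P := toyParams) (j := 0) (dir_zero_lt_one (le_refl 2))
          (side_two_square (P := toyParams) (0 : Fin toyParams.d → ℤ) _ _ (dir_zero_lt_one (le_refl 2)))))
        (2 / 10 ^ 5) (1 / 4)
        (2 * (((Fintype.card (↥(blockBonds (P := toyParams) (j := 0) 0 (fun _ => (0 : ℤ) + 2)) × Fin 3) : ℕ) : ℝ)) /
          (1 - 1 / 2)) := by
  intro r K t s
  have h := gibbs_family_fires (σ := σ) hβ₀ r K t s
  simpa only [pow_zero, one_pow, div_one, Finset.sum_empty, mul_zero, add_zero] using h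

/-- … and the block is NONEMPTY (S89 f1). [folklore] -/
theorem gibbs_family_block_nonempty : (blockBonds (P := toyParams) (j := 0) 0 (fun _ => (0 : ℤ) + 2)).Nonempty :=
  blockBonds_nonempty (side_two_nonwrapping (j := 0) (by rw [toyParams_sitesPerDir]; norm_num) 0)
    (dir_zero_lt_one (le_refl 2)) (side_two_square (P := toyParams) 0 _ _ (dir_zero_lt_one (le_refl 2)))

/-- THE SCALE PROFILE DOES TEND TO ZERO (so the witness is at Bałaban-type scales, not at `η ≡ 1`): `(1∕2)^j → 0`. [folklore] -/
example : Filter.Tendsto (fun j : ℕ => (1 / 2 : ℝ) ^ j) Filter.atTop (nhds 0) :=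
  tendsto_pow_atTop_nhds_zero_of_lt_one (by norm_num) (by norm_num)

end Summit.QuantumFields.BalabanUV.T4Continuum.ShellMeasureLiveEndOneCallGibbsWitness

end
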